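import Summits.QuantumFields.YangMills.Theorems.BalabanUVNodesN18HolonomyLipschitz

/-!
# BalabanUVNodes ∕ node N18 = NE5 — closure-ledger item (iii), (β2) second brick: THE (0.4) LOOP VARIABLES TO FIRST ORDER ARE LIPSCHITZ IN THE CONFIGURATION —
# the per-index first-order error `E_i(U)` of `BlockAveragingEMLLinearised.loop_first_order_le` (the loop variable `W_i = A·B·C⁻¹·S⁻¹` minus its linearisation)
# satisfies `‖E_i(U) − E_i(U′)‖ ≤ 28·ℓ²·δ·sup‖U − U′‖` (`ℓ = (d+2)L`, `ℓδ ≤ 1`) (Track A, DAG node N18 = `T4OutputRate.NE5` :211; cluster K4 «SpineRates», item K3⁷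
# `SpineGivenEndpointR13SepCoPH`; module 23 of seat pub-ymgap-dag-n18-d, strategy s2)

HONEST FRAMING.  Count-neutral kernel bookkeeping (`--supports stmt-QuantumFields-20544 --as helper`); elementary estimates over module 22 (`…N18HolonomyLipschitz`),
PROVED.  NE5 is NOT PRINTED and NOT proved; N18 is NOT discharged; this is link 2 of the C¹ remainder (β2) of the seat's `N18-BETA-SPEC.md`, not the remainder.

WHY.  The C⁰ proof of [Balaban1985Averaging] Prop 3's remainder for the (0.4) average of record (`BlockAveragingEMLLinearised.norm_avgFun_sub_one_sub_linAvg_le`) bounds,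
per ordering index `i = (r, σ, σ′)`, the first-order error of the loop variable `W_i = U(Γ^σ_{y→x})·U([x,x′])·U(Γ^{σ′}_{y′→x′})⁻¹·U(c)⁻¹` by `49(ℓδ)²`
(`loop_first_order_le`), through the decomposition `W_i − 1 − lin = [ABC*S* − 1 − Σ(·−1)] + [C* − 1 + (C−1)] + [S* − 1 + (S−1)] + [A − 1 − Y(Γ_A)] + [B − 1 − Y(Γ_B)]
− [C − 1 − Y(Γ_C)]` (`BlockAveragingEMLProp2.loopHol_eq`).  The C¹ remainder ((β2)) needs the LIPSCHITZ twin of that bound in the configuration; module 22 typed the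
Lipschitz twins of every bracket (products of near-identity factors, the backward-step term, holonomy remainders); this file assembles them along the same
decomposition.

WHAT.  `norm_holAt_sub_one_le_local` (`‖U(Γ) − 1‖ ≤ |Γ|δ`, walk-local, no smallness), `norm_holAt_sub_holAt_le_of_forall`,
`norm_prod4Rem_sub_prod4Rem_le` (module 22 §1 for four factors), ★ `norm_loopRem_sub_loopRem_le` (the statement in the title, constants `28ℓ²δε` under `ℓδ ≤ 1`).
Next links (spec §(β2)): the `exp[mean log]` correction and the assembly.

WHAT THIS IS NOT.  Not the C¹ remainder; not (β); finite tori — not continuum ∕ OS ∕ mass gap ∕ Clay.  0 `def`, 0 `sorry`, standard axioms.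
-/

open scoped BigOperators

namespace YMDAG.N18.HolonomyLipschitz

open Literature.MathematicalPhysics.QuantumFieldTheory.Balaban1983to89
open Literature.MathematicalPhysics.QuantumFieldTheory.Balaban1983to89.T4Continuum
open Literature.MathematicalPhysics.QuantumFieldTheory.Balaban1983to89.BlockAveraging
open Literature.MathematicalPhysics.QuantumFieldTheory.Balaban1983to89.BlockAveragingEMLLinearised (walkSum stepFactor coe_holAt_eq_prod_stepFactor
  length_walk_stairWord_le length_walk_replicate_le)

/-! ## §1 Four factors; walk-local zeroth order -/

section Four

variable {R : Type*} [NormedRing R] [NormOneClass R]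

/-- **Module 22 §1 for FOUR factors**: for `A, B, C, D` and `A′, B′, C′, D′` of norm `≤ 1`, within `θ` of `1`, pairwise within `η`,
`‖(ABCD − 1 − Σ(·−1)) − (A′B′C′D′ − 1 − Σ(·′−1))‖ ≤ 16·θ·η`. [cite: Balaban1985Averaging, Prop. 3 (122)-(123) p.36] -/
theorem norm_prod4Rem_sub_prod4Rem_le {A B C D A' B' C' D' : R} {θ η : ℝ} (hθ : 0 ≤ θ) (hη : 0 ≤ η)
    (hA : ‖A‖ ≤ 1) (hB : ‖B‖ ≤ 1) (hC : ‖C‖ ≤ 1) (hD : ‖D‖ ≤ 1) (hA' : ‖A'‖ ≤ 1) (hB' : ‖B'‖ ≤ 1) (hC' : ‖C'‖ ≤ 1) (hD' : ‖D'‖ ≤ 1)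
    (hA1 : ‖A - 1‖ ≤ θ) (hB1 : ‖B - 1‖ ≤ θ) (hC1 : ‖C - 1‖ ≤ θ) (hD1 : ‖D - 1‖ ≤ θ) (hA'1 : ‖A' - 1‖ ≤ θ) (hB'1 : ‖B' - 1‖ ≤ θ) (hC'1 : ‖C' - 1‖ ≤ θ)
    (hD'1 : ‖D' - 1‖ ≤ θ) (hAA : ‖A - A'‖ ≤ η) (hBB : ‖B - B'‖ ≤ η) (hCC : ‖C - C'‖ ≤ η) (hDD : ‖D - D'‖ ≤ η) :
    ‖(A * B * C * D - 1 - ((A - 1) + (B - 1) + (C - 1) + (D - 1))) - (A' * B' * C' * D' - 1 - ((A' - 1) + (B' - 1) + (C' - 1) + (D' - 1)))‖ ≤ 16 * θ * η := by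
  have h := norm_prodRem_sub_prodRem_le (Prod.fst : R × R → R) (Prod.snd : R × R → R) hθ hη [(A, A'), (B, B'), (C, C'), (D, D')]
    (by intro p hp; simp only [List.mem_cons, List.not_mem_nil, or_false] at hp; rcases hp with rfl | rfl | rfl | rfl <;> assumption)
    (by intro p hp; simp only [List.mem_cons, List.not_mem_nil, or_false] at hp; rcases hp with rfl | rfl | rfl | rfl <;> assumption)
    (by intro p hp; simp only [List.mem_cons, List.not_mem_nil, or_false] at hp; rcases hp with rfl | rfl | rfl | rfl <;> assumption)
    (by intro p hp; simp only [List.mem_cons, List.not_mem_nil, or_false] at hp; rcases hp with rfl | rfl | rfl | rfl <;> assumption)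
    (by intro p hp; simp only [List.mem_cons, List.not_mem_nil, or_false] at hp; rcases hp with rfl | rfl | rfl | rfl <;> assumption)
  have e1 : (([(A, A'), (B, B'), (C, C'), (D, D')].map Prod.fst).prod - 1 - ([(A, A'), (B, B'), (C, C'), (D, D')].map fun p => p.1 - 1).sum) =
      A * B * C * D - 1 - ((A - 1) + (B - 1) + (C - 1) + (D - 1)) := by
    simp only [List.map_cons, List.map_nil, List.prod_cons, List.prod_nil, List.sum_cons, List.sum_nil, mul_one, add_zero, mul_assoc, add_assoc]
  have e2 : (([(A, A'), (B, B'), (C, C'), (D, D')].map Prod.snd).prod - 1 - ([(A, A'), (B, B'), (C, C'), (D, D')].map fun p => p.2 - 1).sum) =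
      A' * B' * C' * D' - 1 - ((A' - 1) + (B' - 1) + (C' - 1) + (D' - 1)) := by
    simp only [List.map_cons, List.map_nil, List.prod_cons, List.prod_nil, List.sum_cons, List.sum_nil, mul_one, add_zero, mul_assoc, add_assoc]
  rw [e1, e2] at h
  have hlen : (([(A, A'), (B, B'), (C, C'), (D, D')] : List (R × R)).length : ℝ) = 4 := by norm_num
  rw [hlen] at h
  have h16 : (4 : ℝ) ^ 2 * θ * η = 16 * θ * η := by norm_num
  rw [h16] at h
  exact h

end Four

section Loop

open scoped Matrix.Norms.L2Operator

variable {n : Type*} [Fintype n] [DecidableEq n] [Nonempty n] {P : Params} {j : ℕ}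

omit [Nonempty n] in
/-- The inverse in `SU(N)` is the conjugate transpose (coercion; public twin `SolovayKitaev.coe_inv`, kept private). [folklore] -/
private theorem coe_inv_su_eq_star (g : Matrix.specialUnitaryGroup n ℂ) : ((g⁻¹ : Matrix.specialUnitaryGroup n ℂ) : Matrix n n ℂ) = star (g : Matrix n n ℂ) := rfl

omit [Nonempty n] in
/-- `‖g‖ ≤ 1` for `g ∈ SU(N)` (in fact `= 1`). [folklore] -/
private theorem norm_coe_su_le_one [Nonempty n] (g : Matrix.specialUnitaryGroup n ℂ) : ‖(g : Matrix n n ℂ)‖ ≤ 1 :=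
  (CStarRing.norm_of_mem_unitary (Matrix.mem_specialUnitaryGroup_iff.1 g.2).1).le

/-- **WALK-LOCAL ZEROTH ORDER, NO SMALLNESS**: `‖U(Γ) − 1‖ ≤ |Γ|·δ` as soon as the bond variables ON `Γ` are within `δ` of `1` (module 22 §1 on the step factors).
[cite: Balaban1985Averaging, (122)-(123) p.36] -/
theorem norm_holAt_sub_one_le_local (U : GaugeField P j (Matrix.specialUnitaryGroup n ℂ)) {δ : ℝ} (γ : List (LStep P j))
    (hU : ∀ s ∈ γ, ‖((U s.bond : Matrix.specialUnitaryGroup n ℂ) : Matrix n n ℂ) - 1‖ ≤ δ) :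
    ‖((holAt U γ : Matrix.specialUnitaryGroup n ℂ) : Matrix n n ℂ) - 1‖ ≤ γ.length * δ := by
  rw [coe_holAt_eq_prod_stepFactor]
  refine norm_prod_map_sub_one_le (stepFactor U) γ (fun s _ => ?_) fun s hs => norm_stepFactor_sub_one_le U s (hU s hs)
  unfold stepFactor; split_ifs
  · exact norm_coe_su_le_one _
  · rw [norm_star]; exact norm_coe_su_le_one _

/-- `‖U(Γ) − U′(Γ)‖ ≤ |Γ|·ε` when the two configurations are within `ε` on the bonds of `Γ`. [cite: Balaban1985Averaging, Prop. 3 p.36] -/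
theorem norm_holAt_sub_holAt_le_of_forall (U U' : GaugeField P j (Matrix.specialUnitaryGroup n ℂ)) {ε : ℝ} (γ : List (LStep P j))
    (h : ∀ s ∈ γ, ‖((U s.bond : Matrix.specialUnitaryGroup n ℂ) : Matrix n n ℂ) - ((U' s.bond : Matrix.specialUnitaryGroup n ℂ) : Matrix n n ℂ)‖ ≤ ε) :
    ‖((holAt U γ : Matrix.specialUnitaryGroup n ℂ) : Matrix n n ℂ) - ((holAt U' γ : Matrix.specialUnitaryGroup n ℂ) : Matrix n n ℂ)‖ ≤ γ.length * ε := by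
  have h1 := norm_holAt_sub_holAt_le U U' γ
  have h2 : (γ.map fun s => ‖((U s.bond : Matrix.specialUnitaryGroup n ℂ) : Matrix n n ℂ) -
      ((U' s.bond : Matrix.specialUnitaryGroup n ℂ) : Matrix n n ℂ)‖).sum ≤ γ.length * ε :=
    sum_map_norm_sub_le (R := Matrix n n ℂ) (fun s : LStep P j => ((U s.bond : Matrix.specialUnitaryGroup n ℂ) : Matrix n n ℂ))
      (fun s => ((U' s.bond : Matrix.specialUnitaryGroup n ℂ) : Matrix n n ℂ)) γ h
  exact h1.trans h2

/-- ★ **THE PER-INDEX FIRST-ORDER ERROR OF THE (0.4) LOOP VARIABLE IS LIPSCHITZ IN THE CONFIGURATION.**  For two configurations with every bond variable within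
`δ` of `1` and within `ε` of each other, `ℓδ ≤ 1` (`ℓ = (d+2)L`), and every coarse bond `c` and ordering index `i`:
`‖E_i(U) − E_i(U′)‖ ≤ 28·ℓ²·δ·ε`, where `E_i(U) = (W_i − 1) − (Y(Γ^σ) + Y([x,x′]) − Y(Γ^{σ′}) − (U(c) − 1))` is the expression bounded by `49(ℓδ)²` in
`BlockAveragingEMLLinearised.loop_first_order_le` — the same decomposition, bracket by bracket through module 22.
[cite: Balaban1985Averaging, Prop. 3 (122)-(123) p.36; Balaban1987RG1, (0.4) p.253] -/
theorem norm_loopRem_sub_loopRem_le (U U' : GaugeField P j (Matrix.specialUnitaryGroup n ℂ)) {δ ε : ℝ} (hδ : 0 ≤ δ) (hε : 0 ≤ ε)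
    (hU : ∀ b, ‖((U b : Matrix.specialUnitaryGroup n ℂ) : Matrix n n ℂ) - 1‖ ≤ δ)
    (hU' : ∀ b, ‖((U' b : Matrix.specialUnitaryGroup n ℂ) : Matrix n n ℂ) - 1‖ ≤ δ)
    (hUU' : ∀ b, ‖((U b : Matrix.specialUnitaryGroup n ℂ) : Matrix n n ℂ) - ((U' b : Matrix.specialUnitaryGroup n ℂ) : Matrix n n ℂ)‖ ≤ ε)
    (hℓδ : ((((P.d + 2) * P.L : ℕ) : ℝ)) * δ ≤ 1) (c : PBond P (j + 1)) (i : Idx P) :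
    ‖((((loopHol U c i : Matrix.specialUnitaryGroup n ℂ) : Matrix n n ℂ) - 1) -
        (walkSum (fun b => ((U b : Matrix.specialUnitaryGroup n ℂ) : Matrix n n ℂ) - 1) (walk (emb c.src) (stairWord i.2.1 (off i.1))) +
          walkSum (fun b => ((U b : Matrix.specialUnitaryGroup n ℂ) : Matrix n n ℂ) - 1)
            (walk (walkEnd (emb c.src) (stairWord i.2.1 (off i.1))) (List.replicate P.L (c.dir, true))) -
          walkSum (fun b => ((U b : Matrix.specialUnitaryGroup n ℂ) : Matrix n n ℂ) - 1) (walk (emb c.tgt) (stairWord i.2.2 (off i.1))) -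
          (((AveragingRT.axialAvg U c : Matrix.specialUnitaryGroup n ℂ) : Matrix n n ℂ) - 1))) -
      ((((loopHol U' c i : Matrix.specialUnitaryGroup n ℂ) : Matrix n n ℂ) - 1) -
        (walkSum (fun b => ((U' b : Matrix.specialUnitaryGroup n ℂ) : Matrix n n ℂ) - 1) (walk (emb c.src) (stairWord i.2.1 (off i.1))) +
          walkSum (fun b => ((U' b : Matrix.specialUnitaryGroup n ℂ) : Matrix n n ℂ) - 1)
            (walk (walkEnd (emb c.src) (stairWord i.2.1 (off i.1))) (List.replicate P.L (c.dir, true))) -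
          walkSum (fun b => ((U' b : Matrix.specialUnitaryGroup n ℂ) : Matrix n n ℂ) - 1) (walk (emb c.tgt) (stairWord i.2.2 (off i.1))) -
          (((AveragingRT.axialAvg U' c : Matrix.specialUnitaryGroup n ℂ) : Matrix n n ℂ) - 1)))‖ ≤
      28 * ((((P.d + 2) * P.L : ℕ) : ℝ)) ^ 2 * δ * ε := by
  -- letters
  set ℓ : ℝ := (((P.d + 2) * P.L : ℕ) : ℝ) with hℓ
  have hℓ3 : (3 : ℝ) ≤ ℓ := by
    have hd := P.hd; have hL := P.hL.2
    have : (3 : ℕ) ≤ (P.d + 2) * P.L := by nlinarith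
    rw [hℓ]; exact_mod_cast this
  have hℓ0 : 0 ≤ ℓ := by linarith
  have hδ1 : δ ≤ 1 := by nlinarith
  set Y : PBond P j → Matrix n n ℂ := fun b => ((U b : Matrix.specialUnitaryGroup n ℂ) : Matrix n n ℂ) - 1 with hY
  set Y' : PBond P j → Matrix n n ℂ := fun b => ((U' b : Matrix.specialUnitaryGroup n ℂ) : Matrix n n ℂ) - 1 with hY'
  -- the four segments
  set γA := walk (emb c.src) (stairWord i.2.1 (off i.1)) with hγA
  set γB := walk (walkEnd (emb c.src) (stairWord i.2.1 (off i.1))) (List.replicate P.L (c.dir, true)) with hγB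
  set γC := walk (emb c.tgt) (stairWord i.2.2 (off i.1)) with hγC
  set γS := walk (emb c.src) (List.replicate P.L (c.dir, true)) with hγS
  have hA_len : (γA.length : ℝ) ≤ ℓ := by rw [hℓ, hγA]; exact_mod_cast length_walk_stairWord_le _ _ _
  have hB_len : (γB.length : ℝ) ≤ ℓ := by rw [hℓ, hγB]; exact_mod_cast length_walk_replicate_le _ _ _
  have hC_len : (γC.length : ℝ) ≤ ℓ := by rw [hℓ, hγC]; exact_mod_cast length_walk_stairWord_le _ _ _
  have hS_len : (γS.length : ℝ) ≤ ℓ := by rw [hℓ, hγS]; exact_mod_cast length_walk_replicate_le _ _ _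
  have hS : AveragingRT.axialAvg U c = holAt U γS := axialAvg_eq_holAt_walk U c
  have hS' : AveragingRT.axialAvg U' c = holAt U' γS := axialAvg_eq_holAt_walk U' c
  set A : Matrix n n ℂ := ((holAt U γA : Matrix.specialUnitaryGroup n ℂ) : Matrix n n ℂ) with hAd
  set B : Matrix n n ℂ := ((holAt U γB : Matrix.specialUnitaryGroup n ℂ) : Matrix n n ℂ) with hBd
  set C : Matrix n n ℂ := ((holAt U γC : Matrix.specialUnitaryGroup n ℂ) : Matrix n n ℂ) with hCd
  set S : Matrix n n ℂ := ((holAt U γS : Matrix.specialUnitaryGroup n ℂ) : Matrix n n ℂ) with hSd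
  set A' : Matrix n n ℂ := ((holAt U' γA : Matrix.specialUnitaryGroup n ℂ) : Matrix n n ℂ) with hA'd
  set B' : Matrix n n ℂ := ((holAt U' γB : Matrix.specialUnitaryGroup n ℂ) : Matrix n n ℂ) with hB'd
  set C' : Matrix n n ℂ := ((holAt U' γC : Matrix.specialUnitaryGroup n ℂ) : Matrix n n ℂ) with hC'd
  set S' : Matrix n n ℂ := ((holAt U' γS : Matrix.specialUnitaryGroup n ℂ) : Matrix n n ℂ) with hS'd
  -- zeroth order (walk-local): every segment within `ℓδ` of `1`
  have h0 : ∀ (V : GaugeField P j (Matrix.specialUnitaryGroup n ℂ)), (∀ b, ‖((V b : Matrix.specialUnitaryGroup n ℂ) : Matrix n n ℂ) - 1‖ ≤ δ) →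
      ∀ γ : List (LStep P j), (γ.length : ℝ) ≤ ℓ → ‖((holAt V γ : Matrix.specialUnitaryGroup n ℂ) : Matrix n n ℂ) - 1‖ ≤ ℓ * δ :=
    fun V hV γ hγ => (norm_holAt_sub_one_le_local V γ fun s _ => hV s.bond).trans (mul_le_mul_of_nonneg_right hγ hδ)
  have hA1 := h0 U hU γA hA_len; have hB1 := h0 U hU γB hB_len; have hC1 := h0 U hU γC hC_len; have hS1 := h0 U hU γS hS_len
  have hA'1 := h0 U' hU' γA hA_len; have hB'1 := h0 U' hU' γB hB_len; have hC'1 := h0 U' hU' γC hC_len; have hS'1 := h0 U' hU' γS hS_len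
  have hstar1 : ∀ X : Matrix n n ℂ, ‖X - 1‖ ≤ ℓ * δ → ‖star X - 1‖ ≤ ℓ * δ := fun X hX => by
    rw [← star_one (R := Matrix n n ℂ), ← star_sub, norm_star]; exact hX
  -- Lipschitz of the segments: within `ℓε`
  have hL : ∀ γ : List (LStep P j), (γ.length : ℝ) ≤ ℓ →
      ‖((holAt U γ : Matrix.specialUnitaryGroup n ℂ) : Matrix n n ℂ) - ((holAt U' γ : Matrix.specialUnitaryGroup n ℂ) : Matrix n n ℂ)‖ ≤ ℓ * ε :=
    fun γ hγ => (norm_holAt_sub_holAt_le_of_forall U U' γ fun s _ => hUU' s.bond).trans (mul_le_mul_of_nonneg_right hγ hε)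
  have hAA := hL γA hA_len; have hBB := hL γB hB_len; have hCC := hL γC hC_len; have hSS := hL γS hS_len
  have hstarL : ∀ X X' : Matrix n n ℂ, ‖X - X'‖ ≤ ℓ * ε → ‖star X - star X'‖ ≤ ℓ * ε := fun X X' h => by rw [← star_sub, norm_star]; exact h
  have hn1 : ∀ (V : GaugeField P j (Matrix.specialUnitaryGroup n ℂ)) (γ : List (LStep P j)),
      ‖((holAt V γ : Matrix.specialUnitaryGroup n ℂ) : Matrix n n ℂ)‖ ≤ 1 := fun V γ => norm_coe_su_le_one _
  have hn1s : ∀ (V : GaugeField P j (Matrix.specialUnitaryGroup n ℂ)) (γ : List (LStep P j)),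
      ‖star ((holAt V γ : Matrix.specialUnitaryGroup n ℂ) : Matrix n n ℂ)‖ ≤ 1 := fun V γ => by rw [norm_star]; exact norm_coe_su_le_one _
  -- (1) the four-factor remainder
  have h4 := norm_prod4Rem_sub_prod4Rem_le (R := Matrix n n ℂ) (mul_nonneg hℓ0 hδ) (mul_nonneg hℓ0 hε) (hn1 U γA) (hn1 U γB) (hn1s U γC) (hn1s U γS)
    (hn1 U' γA) (hn1 U' γB) (hn1s U' γC) (hn1s U' γS) hA1 hB1 (hstar1 _ hC1) (hstar1 _ hS1) hA'1 hB'1 (hstar1 _ hC'1) (hstar1 _ hS'1) hAA hBB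
    (hstarL _ _ hCC) (hstarL _ _ hSS)
  -- (2),(3) the backward-step terms of the two inverted segments
  have h2 := norm_starRem_sub_starRem_le (holAt U γC) (holAt U' γC) hC1 hC'1 hCC (mul_nonneg hℓ0 hδ) hℓδ (mul_nonneg hℓ0 hε)
  have h3 := norm_starRem_sub_starRem_le (holAt U γS) (holAt U' γS) hS1 hS'1 hSS (mul_nonneg hℓ0 hδ) hℓδ (mul_nonneg hℓ0 hε)
  -- (4),(5),(6) the segment first-order remainders
  have hrem : ∀ γ : List (LStep P j), (γ.length : ℝ) ≤ ℓ →
      ‖(((holAt U γ : Matrix.specialUnitaryGroup n ℂ) : Matrix n n ℂ) - 1 - walkSum Y γ) -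
          (((holAt U' γ : Matrix.specialUnitaryGroup n ℂ) : Matrix n n ℂ) - 1 - walkSum Y' γ)‖ ≤ 2 * ℓ ^ 2 * δ * ε := by
    intro γ hγ
    have h := norm_holAtRem_sub_holAtRem_le U U' hδ hδ1 hε γ (fun s _ => hU s.bond) (fun s _ => hU' s.bond) fun s _ => hUU' s.bond
    have hm0 : (0 : ℝ) ≤ γ.length := Nat.cast_nonneg _
    have hb : ((γ.length : ℝ) ^ 2 + 3 * γ.length) * δ * ε ≤ 2 * ℓ ^ 2 * δ * ε := by
      have : (γ.length : ℝ) ^ 2 + 3 * γ.length ≤ 2 * ℓ ^ 2 := by nlinarith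
      exact mul_le_mul_of_nonneg_right (mul_le_mul_of_nonneg_right this hδ) hε
    exact h.trans hb
  have h5A := hrem γA hA_len; have h5B := hrem γB hB_len; have h5C := hrem γC hC_len
  -- the loop variables as products
  have hW : ((loopHol U c i : Matrix.specialUnitaryGroup n ℂ) : Matrix n n ℂ) = A * B * star C * star S := by
    rw [BlockAveragingEMLProp2.loopHol_eq U c i, hS, Submonoid.coe_mul, Submonoid.coe_mul, Submonoid.coe_mul, coe_inv_su_eq_star, coe_inv_su_eq_star]
  have hW' : ((loopHol U' c i : Matrix.specialUnitaryGroup n ℂ) : Matrix n n ℂ) = A' * B' * star C' * star S' := by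
    rw [BlockAveragingEMLProp2.loopHol_eq U' c i, hS', Submonoid.coe_mul, Submonoid.coe_mul, Submonoid.coe_mul, coe_inv_su_eq_star, coe_inv_su_eq_star]
  have hSm : ((AveragingRT.axialAvg U c : Matrix.specialUnitaryGroup n ℂ) : Matrix n n ℂ) = S := by rw [hSd, hS]
  have hSm' : ((AveragingRT.axialAvg U' c : Matrix.specialUnitaryGroup n ℂ) : Matrix n n ℂ) = S' := by rw [hS'd, hS']
  -- assemble
  have e : ((A * B * star C * star S - 1) - (walkSum Y γA + walkSum Y γB - walkSum Y γC - (S - 1))) -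
      ((A' * B' * star C' * star S' - 1) - (walkSum Y' γA + walkSum Y' γB - walkSum Y' γC - (S' - 1))) =
      ((A * B * star C * star S - 1 - ((A - 1) + (B - 1) + (star C - 1) + (star S - 1))) -
        (A' * B' * star C' * star S' - 1 - ((A' - 1) + (B' - 1) + (star C' - 1) + (star S' - 1)))) +
      ((star C - 1 + (C - 1)) - (star C' - 1 + (C' - 1))) + ((star S - 1 + (S - 1)) - (star S' - 1 + (S' - 1))) +
      ((A - 1 - walkSum Y γA) - (A' - 1 - walkSum Y' γA)) + ((B - 1 - walkSum Y γB) - (B' - 1 - walkSum Y' γB)) -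
      ((C - 1 - walkSum Y γC) - (C' - 1 - walkSum Y' γC)) := by abel
  rw [hW, hW', hSm, hSm', e]
  calc _ ≤ ‖(A * B * star C * star S - 1 - ((A - 1) + (B - 1) + (star C - 1) + (star S - 1))) -
          (A' * B' * star C' * star S' - 1 - ((A' - 1) + (B' - 1) + (star C' - 1) + (star S' - 1)))‖ +
        ‖(star C - 1 + (C - 1)) - (star C' - 1 + (C' - 1))‖ + ‖(star S - 1 + (S - 1)) - (star S' - 1 + (S' - 1))‖ +
        ‖(A - 1 - walkSum Y γA) - (A' - 1 - walkSum Y' γA)‖ + ‖(B - 1 - walkSum Y γB) - (B' - 1 - walkSum Y' γB)‖ +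
        ‖(C - 1 - walkSum Y γC) - (C' - 1 - walkSum Y' γC)‖ := by
          refine (norm_sub_le _ _).trans (add_le_add ?_ le_rfl)
          refine (norm_add_le _ _).trans (add_le_add ?_ le_rfl)
          refine (norm_add_le _ _).trans (add_le_add ?_ le_rfl)
          refine (norm_add_le _ _).trans (add_le_add ?_ le_rfl)
          exact (norm_add_le _ _).trans (add_le_add le_rfl le_rfl)
    _ ≤ 16 * (ℓ * δ) * (ℓ * ε) + 3 * (ℓ * δ) * (ℓ * ε) + 3 * (ℓ * δ) * (ℓ * ε) + 2 * ℓ ^ 2 * δ * ε + 2 * ℓ ^ 2 * δ * ε + 2 * ℓ ^ 2 * δ * ε := by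
          gcongr
    _ = 28 * ℓ ^ 2 * δ * ε := by ring

end Loop

end YMDAG.N18.HolonomyLipschitz
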